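import Mathlib
import Summits.MatrixMultiplication.MatrixMultiplication.Theses.FourierTwoFamiliesModP
import Summits.MatrixMultiplication.MatrixMultiplication.Theorems.FourierTwoFamiliesModPCyclicReductionTransfer
import Literature.Computability.AlgebraicComplexity.SimultaneousDoubleProduct

/-!
# The crux forces packing-tight SDPP families at every co-volume scale: padding + transfer (support file)

Item `stmt-MatrixMultiplication-14308` (`FourierTwoFamiliesModP.PrimeTwoFamilies`, CKSU 2005 Conj. 4.7 with
prime cyclic hosts), line `Sketch` (cycle c1, capacity-gadget skeleton `Cruxes/PrimeTwoFamilies/Lines/Sketch.lean`),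
registered stub `stub_packingTightOfCrux`.

PACKING-TIGHT AT SCALE `γ ∈ (0, 1)`: for every `ε > 0` arbitrarily large primes `p` carry SDPP families
(clauses (W), (X) of the simultaneous double product property) in `ℤ/p` with all co-volumes
`|A i| |B i| ≥ p ^ γ` and `n ≥ p ^ (1 - γ/2 - ε)` pairs.  The crux is the scale `γ → 1`; this file pushes
a crux witness DOWN to any scale `γ < 1` by PADDING and TRANSFER:

* `sdpp_pad` — padding with the singleton design: if `(A i, B i)_{i<n}` is SDPP in `H`, then the `n·M`
  pairs `(A i ×ˢ {t}, B i ×ˢ {t})`, `t ∈ ℤ/M` (indexed by `c : Fin (n * M)`, `i = c.divNat`,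
  `t = c.modNat`), are SDPP in `H × ℤ/M` with the same co-volumes (second components force equal
  remainders, first components equal quotients);
* `stub_packingTightOfCrux` — take a crux witness at slice `δ = min (ε/3) ((1-γ)/2)`: `n₁` pairs in `ℤ/p₁`,
  `p₁ ≤ n₁ ^ (2+δ)`, co-volumes `≥ n₁ ^ (2-δ)`; pad with `M = ⌊x / (18 p₁)⌋₊`, `x = n₁ ^ ((2-δ)/γ)`;
  move into a Bertrand prime `p ≤ 2·3²·p₁·M ≤ x` by the tree's carry-free transfer
  `Theorems.exists_prime_sdpp_of_addEquiv` (route support CyclicReduction).  Then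
  `p ^ γ ≤ x ^ γ = n₁ ^ (2-δ) ≤ |A i| |B i|`, and `n = n₁ M ≥ n₁ x / (36 p₁) ≥ x ^ (1-γ/2-ε) ≥ p ^ (1-γ/2-ε)`
  by the exponent gap `3δ/2 < ε (2-δ)/γ` once `n₁` is large (`pad_exponents`, whose only analytic
  input is `eventually_dominates`: `K m ^ a ≤ m ^ b` for large `m` when `a < b`).
-/

-- single-conjunct summit: the mandated namespace repeats `MatrixMultiplication` (summit = sub-problem).
set_option linter.dupNamespace false

namespace Summit.MatrixMultiplication.MatrixMultiplication.Theorems.PrimeTwoFamilies.CapacityLift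

open Finset
open Summit.MatrixMultiplication.MatrixMultiplication.Theses
open Summit.MatrixMultiplication.MatrixMultiplication.Theorems
open Literature.Computability.AlgebraicComplexity

section Padding

variable {H : Type*} [AddCommGroup H] {n M : ℕ} {A B : Fin n → Finset H}

/-- An index of `Fin (n * M)` is determined by its quotient `divNat` and its remainder `modNat`. -/
private theorem fin_eq_of_divNat_eq_of_modNat_eq {i k : Fin (n * M)} (h1 : i.divNat = k.divNat)
    (h2 : i.modNat = k.modNat) : i = k := by
  have h1' : (i : ℕ) / M = (k : ℕ) / M := congrArg Fin.val h1
  have h2' : (i : ℕ) % M = (k : ℕ) % M := congrArg Fin.val h2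
  ext
  rw [← Nat.div_add_mod (i : ℕ) M, h1', h2', Nat.div_add_mod]

/-- Remainders `modNat` of indices of `Fin (n * M)` are determined by their classes in `ZMod M`
(they are `< M`). -/
private theorem modNat_eq_of_cast_eq {i k : Fin (n * M)}
    (h : ((i.modNat : ℕ) : ZMod M) = ((k.modNat : ℕ) : ZMod M)) : i.modNat = k.modNat := by
  rw [ZMod.natCast_eq_natCast_iff', Nat.mod_eq_of_lt (Fin.is_lt _),
    Nat.mod_eq_of_lt (Fin.is_lt _)] at h
  exact Fin.ext h

/-- **Padding with the singleton design.**  Let `(A i, B i)_{i<n}` satisfy the two clauses (W) (each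
pair direct: `(a - a') + (b - b') = 0 → a = a' ∧ b = b'` inside a pair) and (X) (simultaneity:
`a ∈ A i, a' ∈ A j, b ∈ B j, b' ∈ B k`, `(a - a') + (b - b') = 0 → i = k`) of the simultaneous double
product property in an abelian group `H`.  Then so does the padded family of `n * M` pairs in
`H × ZMod M`, `A' c = A c.divNat ×ˢ {c.modNat}`, `B' c = B c.divNat ×ˢ {c.modNat}` (`c : Fin (n * M)`,
the remainder `c.modNat < M` read in `ZMod M`): (W) holds componentwise, and in (X) the second
components give `i.modNat - j.modNat + (j.modNat - k.modNat) = 0`, i.e. `i.modNat = k.modNat`, while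
the first components give `i.divNat = k.divNat` by (X) in `H`. -/
theorem sdpp_pad (A' B' : Fin (n * M) → Finset (H × ZMod M))
    (hA' : ∀ c, A' c = A c.divNat ×ˢ ({((c.modNat : ℕ) : ZMod M)} : Finset (ZMod M)))
    (hB' : ∀ c, B' c = B c.divNat ×ˢ ({((c.modNat : ℕ) : ZMod M)} : Finset (ZMod M)))
    (hW : ∀ i : Fin n, ∀ a ∈ A i, ∀ a' ∈ A i, ∀ b ∈ B i, ∀ b' ∈ B i,
      (a - a') + (b - b') = 0 → a = a' ∧ b = b')
    (hX : ∀ i j k : Fin n, ∀ a ∈ A i, ∀ a' ∈ A j, ∀ b ∈ B j, ∀ b' ∈ B k,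
      (a - a') + (b - b') = 0 → i = k) :
    (∀ c : Fin (n * M), ∀ a ∈ A' c, ∀ a' ∈ A' c, ∀ b ∈ B' c, ∀ b' ∈ B' c,
        (a - a') + (b - b') = 0 → a = a' ∧ b = b') ∧
    (∀ i j k : Fin (n * M), ∀ a ∈ A' i, ∀ a' ∈ A' j, ∀ b ∈ B' j, ∀ b' ∈ B' k,
        (a - a') + (b - b') = 0 → i = k) := by
  refine ⟨?_, ?_⟩
  · intro c a ha a' ha' b hb b' hb' h
    simp only [hA', hB', Finset.mem_product, Finset.mem_singleton] at ha ha' hb hb'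
    have h1 : (a.1 - a'.1) + (b.1 - b'.1) = 0 := by
      have := congrArg Prod.fst h; simpa using this
    obtain ⟨e1, f1⟩ := hW c.divNat a.1 ha.1 a'.1 ha'.1 b.1 hb.1 b'.1 hb'.1 h1
    exact ⟨Prod.ext e1 (ha.2.trans ha'.2.symm), Prod.ext f1 (hb.2.trans hb'.2.symm)⟩
  · intro i j k a ha a' ha' b hb b' hb' h
    simp only [hA', hB', Finset.mem_product, Finset.mem_singleton] at ha ha' hb hb'
    have h1 : (a.1 - a'.1) + (b.1 - b'.1) = 0 := by
      have := congrArg Prod.fst h; simpa using this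
    have h2 : (a.2 - a'.2) + (b.2 - b'.2) = 0 := by
      have := congrArg Prod.snd h; simpa using this
    have hdiv : i.divNat = k.divNat :=
      hX _ _ _ a.1 ha.1 a'.1 ha'.1 b.1 hb.1 b'.1 hb'.1 h1
    have hmod : i.modNat = k.modNat := by
      refine modNat_eq_of_cast_eq ?_
      rw [ha.2, ha'.2, hb.2, hb'.2, sub_add_sub_cancel, sub_eq_zero] at h2
      exact h2
    exact fin_eq_of_divNat_eq_of_modNat_eq hdiv hmod

omit [AddCommGroup H] in
/-- Padding keeps co-volumes: `|A c.divNat ×ˢ {c.modNat}| = |A c.divNat|`. -/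
theorem card_pad (A' : Fin (n * M) → Finset (H × ZMod M))
    (hA' : ∀ c, A' c = A c.divNat ×ˢ ({((c.modNat : ℕ) : ZMod M)} : Finset (ZMod M)))
    (c : Fin (n * M)) : (A' c).card = (A c.divNat).card := by
  rw [hA', Finset.card_product, Finset.card_singleton, mul_one]

end Padding

section Exponents

/-- A constant multiple of a smaller real power of `m` is eventually dominated by a larger power:
if `0 < K` and `a < b` then `K * m ^ a ≤ m ^ b` for all naturals `m ≥ ⌈K ^ (1/(b-a))⌉₊ + 1`. -/
-- adapted from `LadderLift.eventually_dominates` (private) in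
-- `Theorems/FourierTwoFamiliesModPPrimeTwoFamiliesStubBookkeeping.lean`
private theorem eventually_dominates (K a b : ℝ) (hK : 0 < K) (hab : a < b) :
    ∃ m₀ : ℕ, ∀ m : ℕ, m₀ ≤ m → K * (m : ℝ) ^ a ≤ (m : ℝ) ^ b := by
  have hc : 0 < b - a := sub_pos.mpr hab
  refine ⟨⌈K ^ (b - a)⁻¹⌉₊ + 1, fun m hm => ?_⟩
  have hm1 : ((⌈K ^ (b - a)⁻¹⌉₊ + 1 : ℕ) : ℝ) ≤ m := by exact_mod_cast hm
  push_cast at hm1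
  have hceil : K ^ (b - a)⁻¹ ≤ (⌈K ^ (b - a)⁻¹⌉₊ : ℝ) := Nat.le_ceil _
  have hT0 : (0 : ℝ) ≤ K ^ (b - a)⁻¹ := Real.rpow_nonneg hK.le _
  have hKm' : K ^ (b - a)⁻¹ ≤ (m : ℝ) := by linarith
  have hm0 : (0 : ℝ) < m := by linarith
  have hKm : K ≤ (m : ℝ) ^ (b - a) := by
    calc K = (K ^ (b - a)⁻¹) ^ (b - a) := (Real.rpow_inv_rpow hK.le hc.ne').symm
      _ ≤ (m : ℝ) ^ (b - a) := Real.rpow_le_rpow hT0 hKm' hc.le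
  calc K * (m : ℝ) ^ a ≤ (m : ℝ) ^ (b - a) * (m : ℝ) ^ a :=
        mul_le_mul_of_nonneg_right hKm (Real.rpow_nonneg hm0.le _)
    _ = (m : ℝ) ^ b := by rw [← Real.rpow_add hm0, sub_add_cancel]

/-- **Exponent bookkeeping of the padding.**  For `0 < γ < 1` and `0 < ε` put
`δ := min (ε/3) ((1-γ)/2)` (so `0 < δ ≤ 1`).  Then for every large `n₁` and every `0 < p₁ ≤ n₁ ^ (2+δ)`
the padding length `M := ⌊x / (18 p₁)⌋₊`, `x := n₁ ^ ((2-δ)/γ)`, satisfies `1 ≤ M`, and every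
`p ≤ 18 p₁ M` (so `p ≤ x`) has `p ^ γ ≤ n₁ ^ (2-δ)` and, when the exponent `1 - γ/2 - ε` is positive,
`p ^ (1-γ/2-ε) ≤ n₁ M`.  The two exponent gaps used (through `eventually_dominates` with `K = 36`) are
`2 + δ < (2-δ)/γ` (giving `x ≥ 36 p₁`, hence `M ≥ x / (36 p₁) ≥ 1`) and
`1 + δ < ((2-δ)/γ)(γ/2 + ε)` (giving `36 n₁ ^ (2+δ) x ^ (1-γ/2-ε) ≤ n₁ x ≤ 36 p₁ n₁ M`). -/
private theorem pad_exponents {γ ε : ℝ} (hγ : 0 < γ) (hγ1 : γ < 1) (hε : 0 < ε) :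
    ∃ δ : ℝ, 0 < δ ∧ δ ≤ 1 ∧ ∃ N : ℕ, ∀ n₁ : ℕ, N ≤ n₁ → ∀ p₁ : ℕ, 0 < p₁ →
      (p₁ : ℝ) ≤ (n₁ : ℝ) ^ (2 + δ) →
      ∃ M : ℕ, 1 ≤ M ∧ ∀ p : ℕ, p ≤ 18 * p₁ * M →
        (p : ℝ) ^ γ ≤ (n₁ : ℝ) ^ (2 - δ) ∧
        (0 < 1 - γ / 2 - ε → (p : ℝ) ^ (1 - γ / 2 - ε) ≤ ((n₁ * M : ℕ) : ℝ)) := by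
  /- the slice `δ` -/
  set δ : ℝ := min (ε / 3) ((1 - γ) / 2) with hδdef
  have hδ : 0 < δ := lt_min (by positivity) (by linarith)
  have hδε : δ ≤ ε / 3 := min_le_left _ _
  have hδγ : δ ≤ (1 - γ) / 2 := min_le_right _ _
  have hδ1 : δ ≤ 1 := by linarith
  /- the exponent `θ = (2-δ)/γ` of `x = n₁ ^ θ`, and the two gaps -/
  set θ : ℝ := (2 - δ) / γ with hθ
  have hθγ : θ * γ = 2 - δ := div_mul_cancel₀ _ hγ.ne'
  have hδγ' : δ * γ < δ := mul_lt_of_lt_one_right hδ hγ1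
  have hgap₁ : 2 + δ < θ := by
    rw [hθ, lt_div_iff₀ hγ]
    nlinarith
  have hgap₂ : 1 + δ < θ * (γ / 2 + ε) := by
    rw [hθ, div_mul_eq_mul_div, lt_div_iff₀ hγ]
    have h2 : δ * ε ≤ 1 / 2 * ε := mul_le_mul_of_nonneg_right (by linarith) hε.le
    nlinarith
  obtain ⟨N₁, hN₁⟩ := eventually_dominates 36 _ _ (by norm_num) hgap₁
  obtain ⟨N₂, hN₂⟩ := eventually_dominates 36 _ _ (by norm_num) hgap₂
  refine ⟨δ, hδ, hδ1, max 1 (max N₁ N₂), fun n₁ hn₁ p₁ hp₁ hp₁n => ?_⟩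
  have hn1 : 1 ≤ n₁ := le_trans (le_max_left _ _) hn₁
  have hnN₁ : N₁ ≤ n₁ := le_trans (le_trans (le_max_left _ _) (le_max_right _ _)) hn₁
  have hnN₂ : N₂ ≤ n₁ := le_trans (le_trans (le_max_right _ _) (le_max_right _ _)) hn₁
  have hn0 : (0 : ℝ) < n₁ := by exact_mod_cast hn1
  have hp₁0 : (0 : ℝ) < p₁ := by exact_mod_cast hp₁
  /- `x = n₁ ^ θ ≥ 36 p₁` and `M = ⌊x / (18 p₁)⌋₊` -/
  set x : ℝ := (n₁ : ℝ) ^ θ with hx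
  have hx0 : 0 < x := Real.rpow_pos_of_pos hn0 _
  have h36 : 36 * (p₁ : ℝ) ≤ x :=
    calc 36 * (p₁ : ℝ) ≤ 36 * (n₁ : ℝ) ^ (2 + δ) := by linarith
      _ ≤ x := hN₁ n₁ hnN₁
  have h18p : (0 : ℝ) < 18 * p₁ := by positivity
  have h36p : (0 : ℝ) < 36 * p₁ := by positivity
  set M : ℕ := ⌊x / (18 * p₁)⌋₊ with hM
  have hMle : (M : ℝ) * (18 * p₁) ≤ x := by
    rw [← le_div_iff₀ h18p]
    exact Nat.floor_le (div_nonneg hx0.le h18p.le)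
  have hx36 : 1 ≤ x / (36 * p₁) := by rw [le_div_iff₀ h36p]; linarith
  have hMge' : x / (36 * p₁) ≤ (M : ℝ) := by
    have h1 : x / (18 * p₁) < (M : ℝ) + 1 := Nat.lt_floor_add_one _
    have h2 : x / (18 * p₁) = 2 * (x / (36 * p₁)) := by
      field_simp
      ring
    linarith
  have hMge : x ≤ (M : ℝ) * (36 * p₁) := (div_le_iff₀ h36p).1 hMge'
  have hM1R : (1 : ℝ) ≤ M := hx36.trans hMge'
  have hM1 : 1 ≤ M := by exact_mod_cast hM1R
  refine ⟨M, hM1, fun p hp => ?_⟩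
  have hpx : (p : ℝ) ≤ x := by
    have h1 : (p : ℝ) ≤ 18 * p₁ * M := by exact_mod_cast hp
    linarith
  have hp0 : (0 : ℝ) ≤ p := Nat.cast_nonneg p
  refine ⟨?_, fun he => ?_⟩
  · /- `p ^ γ ≤ x ^ γ = n₁ ^ (2-δ)` -/
    calc (p : ℝ) ^ γ ≤ x ^ γ := Real.rpow_le_rpow hp0 hpx hγ.le
      _ = (n₁ : ℝ) ^ (2 - δ) := by rw [hx, ← Real.rpow_mul hn0.le, hθγ]
  · /- `p ^ e ≤ x ^ e ≤ n₁ M`, `e = 1 - γ/2 - ε`: multiply by `36 p₁` -/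
    have hxe : x ^ (1 - γ / 2 - ε) * x ^ (γ / 2 + ε) = x := by
      rw [← Real.rpow_add hx0, show (1 - γ / 2 - ε) + (γ / 2 + ε) = (1 : ℝ) by ring,
        Real.rpow_one]
    have hxsplit : x ^ (γ / 2 + ε) = (n₁ : ℝ) ^ (θ * (γ / 2 + ε)) := by
      rw [hx, ← Real.rpow_mul hn0.le]
    have hn2 : (n₁ : ℝ) ^ (2 + δ) = (n₁ : ℝ) ^ (1 + δ) * n₁ := by
      rw [show (2 : ℝ) + δ = (1 + δ) + 1 by ring, Real.rpow_add_one hn0.ne']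
    have hxe0 : 0 ≤ x ^ (1 - γ / 2 - ε) := Real.rpow_nonneg hx0.le _
    have key : x ^ (1 - γ / 2 - ε) * (36 * p₁) ≤ ((n₁ * M : ℕ) : ℝ) * (36 * p₁) := by
      calc x ^ (1 - γ / 2 - ε) * (36 * p₁)
          ≤ x ^ (1 - γ / 2 - ε) * (36 * (n₁ : ℝ) ^ (2 + δ)) :=
            mul_le_mul_of_nonneg_left (by linarith) hxe0
        _ = x ^ (1 - γ / 2 - ε) * (36 * (n₁ : ℝ) ^ (1 + δ)) * n₁ := by rw [hn2]; ring
        _ ≤ x ^ (1 - γ / 2 - ε) * (n₁ : ℝ) ^ (θ * (γ / 2 + ε)) * n₁ :=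
            mul_le_mul_of_nonneg_right (mul_le_mul_of_nonneg_left (hN₂ n₁ hnN₂) hxe0) hn0.le
        _ = x * n₁ := by rw [← hxsplit, hxe]
        _ ≤ (M : ℝ) * (36 * p₁) * n₁ := mul_le_mul_of_nonneg_right hMge hn0.le
        _ = ((n₁ * M : ℕ) : ℝ) * (36 * p₁) := by push_cast; ring
    calc (p : ℝ) ^ (1 - γ / 2 - ε) ≤ x ^ (1 - γ / 2 - ε) := Real.rpow_le_rpow hp0 hpx he.le
      _ ≤ ((n₁ * M : ℕ) : ℝ) := le_of_mul_le_mul_right key h36p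

end Exponents

/-- **Stub `stub_packingTightOfCrux`: the crux is packing-tight at every scale `γ ∈ (0, 1)`.**  If
`PrimeTwoFamilies` holds then for every `ε > 0` and `p₀` there is a prime `p ≥ p₀` carrying an SDPP family
(clauses (W), (X)) of `n` pairs in `ZMod p` with all co-volumes `p ^ γ ≤ |A i| |B i|` and
`p ^ (1 - γ/2 - ε) ≤ n`.  Proof: a crux witness at slice `δ = min (ε/3) ((1-γ)/2)` (`pad_exponents`) with
`n₁` large — `n₁` pairs in `ZMod p₁`, `p₁ ≤ n₁ ^ (2+δ)`, co-volumes `≥ n₁ ^ (2-δ)` — is padded with the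
singleton design on `ZMod M`, `M = ⌊n₁ ^ ((2-δ)/γ) / (18 p₁)⌋₊` (`sdpp_pad`: `n₁ M` pairs in
`ZMod p₁ × ZMod M`, same co-volumes), and moved into a prime `p ≤ 2·3²·p₁·M ≤ n₁ ^ ((2-δ)/γ)` by the
carry-free transfer `exists_prime_sdpp_of_addEquiv` (sizes kept); so `p ^ γ ≤ n₁ ^ (2-δ) ≤ |A i||B i|`,
`p ^ (1-γ/2-ε) ≤ n₁ M = n` (or `≤ 1 ≤ n` if the exponent is `≤ 0`), and `p ≥ |A i||B i| ≥ n₁ ≥ p₀`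
(CKSU Prop. 4.6, `card_mul_card_le_of_dpp`). -/
theorem stub_packingTightOfCrux (hT : FourierTwoFamiliesModP.PrimeTwoFamilies)
    {γ : ℝ} (hγ : 0 < γ) (hγ1 : γ < 1) :
    ∀ ε : ℝ, 0 < ε → ∀ p₀ : ℕ, ∃ p ≥ p₀, p.Prime ∧ ∃ (n : ℕ) (A B : Fin n → Finset (ZMod p)),
      (∀ i : Fin n, ∀ a ∈ A i, ∀ a' ∈ A i, ∀ b ∈ B i, ∀ b' ∈ B i,
          (a - a') + (b - b') = 0 → a = a' ∧ b = b') ∧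
      (∀ i j k : Fin n, ∀ a ∈ A i, ∀ a' ∈ A j, ∀ b ∈ B j, ∀ b' ∈ B k,
          (a - a') + (b - b') = 0 → i = k) ∧
      (∀ i : Fin n, (p : ℝ) ^ γ ≤ (((A i).card * (B i).card : ℕ) : ℝ)) ∧
      (p : ℝ) ^ (1 - γ / 2 - ε) ≤ (n : ℝ) := by
  classical
  intro ε hε p₀
  obtain ⟨δ, hδ, hδ1, N, hN⟩ := pad_exponents hγ hγ1 hε
  obtain ⟨n₁, hn₁, p₁, hp₁, A, B, hW, hX, hp₁n, hAB⟩ := hT δ hδ (max N (max p₀ 1))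
  have hNn₁ : N ≤ n₁ := le_trans (le_max_left _ _) hn₁
  have hp₀n₁ : p₀ ≤ n₁ := le_trans (le_trans (le_max_left _ _) (le_max_right _ _)) hn₁
  have hn₁1 : 1 ≤ n₁ := le_trans (le_trans (le_max_right _ _) (le_max_right _ _)) hn₁
  obtain ⟨M, hM1, hM⟩ := hN n₁ hNn₁ p₁ hp₁.pos hp₁n
  /- padding with the singleton design on `ZMod M` -/
  set A' : Fin (n₁ * M) → Finset (ZMod p₁ × ZMod M) :=
    fun c => A c.divNat ×ˢ ({((c.modNat : ℕ) : ZMod M)} : Finset (ZMod M)) with hA'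
  set B' : Fin (n₁ * M) → Finset (ZMod p₁ × ZMod M) :=
    fun c => B c.divNat ×ˢ ({((c.modNat : ℕ) : ZMod M)} : Finset (ZMod M)) with hB'
  have hA'c : ∀ c, A' c = A c.divNat ×ˢ ({((c.modNat : ℕ) : ZMod M)} : Finset (ZMod M)) :=
    fun _ => rfl
  have hB'c : ∀ c, B' c = B c.divNat ×ˢ ({((c.modNat : ℕ) : ZMod M)} : Finset (ZMod M)) :=
    fun _ => rfl
  obtain ⟨hW', hX'⟩ := sdpp_pad A' B' hA'c hB'c hW hX
  /- transfer into a prime cyclic host (tree: route support CyclicReduction, transfer step) -/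
  have hm : ∀ j : Fin 2, 0 < ![p₁, M] j := Fin.forall_fin_two.2 ⟨hp₁.pos, hM1⟩
  obtain ⟨p, hp, hpR, A'', B'', hcard, hW'', hX''⟩ :=
    exists_prime_sdpp_of_addEquiv hW' hX' hm
      (RingEquiv.piFinTwo fun j => ZMod (![p₁, M] j)).symm.toAddEquiv
  have hprod : ∏ j : Fin 2, ![p₁, M] j = p₁ * M := by
    rw [Fin.prod_univ_two]
    rfl
  rw [hprod] at hpR
  have hp18 : p ≤ 18 * p₁ * M :=
    calc p ≤ 2 * (3 ^ 2 * (p₁ * M)) := hpR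
      _ = 18 * p₁ * M := by ring
  obtain ⟨hpγ, hpe⟩ := hM p hp18
  haveI : Fact p.Prime := ⟨hp⟩
  /- co-volumes are kept by padding and by transfer -/
  have hcardAB : ∀ c : Fin (n₁ * M),
      (A'' c).card * (B'' c).card = (A c.divNat).card * (B c.divNat).card := by
    intro c
    obtain ⟨h1, h2⟩ := hcard c
    rw [h1, h2, card_pad A' hA'c, card_pad B' hB'c]
  /- a class exists: `n₁ ≥ 1`, `M ≥ 1` -/
  have hnM : 0 < n₁ * M := Nat.mul_pos hn₁1 hM1
  /- `p ≥ p₀`: `p ≥ |A'' c₀| |B'' c₀| = |A 0| |B 0| ≥ n₁ ^ (2-δ) ≥ n₁ ≥ p₀` -/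
  have hp₀ : p₀ ≤ p := by
    set c₀ : Fin (n₁ * M) := ⟨0, hnM⟩ with hc₀
    have h1 : (A'' c₀).card * (B'' c₀).card ≤ p := by
      have := card_mul_card_le_of_dpp (H := ZMod p) (hW'' c₀)
      rwa [ZMod.card] at this
    rw [hcardAB] at h1
    have hn₁1R : (1 : ℝ) ≤ n₁ := by exact_mod_cast hn₁1
    have h2 : (n₁ : ℝ) ≤ (n₁ : ℝ) ^ (2 - δ) := by
      calc (n₁ : ℝ) = (n₁ : ℝ) ^ (1 : ℝ) := (Real.rpow_one _).symm
        _ ≤ (n₁ : ℝ) ^ (2 - δ) := Real.rpow_le_rpow_of_exponent_le hn₁1R (by linarith)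
    have h3 : (n₁ : ℝ) ≤ (p : ℝ) := (h2.trans (hAB _)).trans (by exact_mod_cast h1)
    have h4 : n₁ ≤ p := by exact_mod_cast h3
    omega
  refine ⟨p, hp₀, hp, n₁ * M, A'', B'', hW'', hX'', ?_, ?_⟩
  · intro c
    rw [hcardAB]
    exact hpγ.trans (hAB _)
  · by_cases he : 0 < 1 - γ / 2 - ε
    · exact hpe he
    · have hp1 : (1 : ℝ) ≤ p := by exact_mod_cast hp.one_lt.le
      have hn1 : (1 : ℝ) ≤ ((n₁ * M : ℕ) : ℝ) := by exact_mod_cast hnM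
      exact (Real.rpow_le_one_of_one_le_of_nonpos hp1 (le_of_not_gt he)).trans hn1

end Summit.MatrixMultiplication.MatrixMultiplication.Theorems.PrimeTwoFamilies.CapacityLift
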